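import Literature.Topology.FourManifolds.KnotGroup
import Literature.Topology.FourManifolds.AlexanderModuleTrivializer
import HarnessLib

/-!
# Knot groups: `Δ_K(1) = ±1` from finite generation of the knot group

Companion ("proofs") file of `Literature.Topology.FourManifolds.KnotGroup`, towards discharging
the named fact `Literature.Topology.FourManifolds.Knot.IsAlexanderPolynomial.isUnit_eval_one` (`Δ_K(1) = ±1` for every
Alexander polynomial `Δ` of a knot `K`).

## Content

The classical proof (Crowell–Fox, *Introduction to Knot Theory*, Ch. IX (1.1)–(1.2)) has two
ingredients of a different nature:

* **algebra** — for a *finitely generated* group `G` with `Gᵃᵇ ≃ ℤ`, the trivializer `t ↦ 1` maps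
  the Alexander (order) ideal onto `ℤ`, so any generator `Δ` has `Δ(1) = ±1`. This is proved in
  `AlexanderModuleTrivializer` (`Literature.Topology.FourManifolds.IsAlexanderPolynomial.isUnit_eval_one_of_fg`);
* **topology** — the group `π₁(S³ ∖ K)` of a (smooth, hence tame) knot is finitely generated: it
  has the finite over/Wirtinger presentation read off a regular projection (Crowell–Fox Ch. VI
  (2.5), for tame knots; smooth (`C¹`) knots are tame, Ch. I (2.1) and Appendix I; the groups of
  `S³ ∖ K` and `R³ ∖ K` are isomorphic by a standard Seifert–van Kampen argument, cf. Rolfsen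
  (1976), Ch. 3). Mathlib has neither the
  Seifert–van Kampen theorem for these spaces nor tubular neighbourhoods of submanifolds of
  spheres, so this ingredient is recorded as the named fact `Literature.Topology.FourManifolds.Knot.fg_group` (no proof here).

With the intrinsic Fitting ideal of `AlexanderModule` (which is `⊥` for a module that is not
finitely generated) the topological ingredient cannot be bypassed: a group with `Gᵃᵇ ≃ ℤ` and
non-finitely-generated `G'/G''` has `Δ = 0` as an "Alexander polynomial".

## Main statements

* `Literature.Topology.FourManifolds.Knot.fg_group` (named fact): knot groups are finitely generated.
* `Literature.Topology.FourManifolds.Knot.IsAlexanderPolynomial.isUnit_eval_one_of_fg_group`: the named fact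
  `Knot.IsAlexanderPolynomial.isUnit_eval_one` follows from `Knot.fg_group` (real proof).
* `Literature.Topology.FourManifolds.Knot.IsAlexanderPolynomial.isUnit_eval_one_of_groupFG`: unconditional pointwise form for a
  knot whose groups are known to be finitely generated.

## Sources

R. H. Crowell, R. H. Fox, *Introduction to Knot Theory* (Ginn 1963; Springer GTM 57, 1977),
Ch. I (2.1), Ch. VI (2.5), Ch. IX (1.1)–(1.2); D. Rolfsen, *Knots and Links* (1976), §3.A, §3.D,
§8.D.
-/

noncomputable section

open scoped LaurentPolynomial

namespace Literature.Topology.FourManifolds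

namespace Knot

/-- **Knot groups are finitely generated**: for every (smooth) knot `K : S¹ ↪ S³` and base point
`x ∈ S³ ∖ K`, the knot group `π₁(S³ ∖ K, x)` is finitely generated — indeed finitely presented by
the over presentation (Wirtinger presentation) read off a regular projection of a polygonal
representative. Crowell–Fox prove this for tame knots in `R³` (Ch. VI (2.5)); smooth knots are
tame (Ch. I (2.1), Appendix I) and `π₁(S³ ∖ K) ≅ π₁(R³ ∖ K)` (Seifert–van Kampen; Rolfsen (1976),
Ch. 3). Named fact (no proof here: Mathlib
lacks the Seifert–van Kampen theorem / tubular neighbourhoods needed); it is the only non-algebraic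
input to `Δ_K(1) = ±1`. [cite: CrowellFox1963, Ch. VI (2.5); Ch. I (2.1)] -/
def fg_group : Prop :=
  ∀ (K : Knot) (x : K.complement), Group.FG (K.group x)

/-- **`Δ_K(1) = ±1` from finite generation of knot groups.** The named fact
`Knot.IsAlexanderPolynomial.isUnit_eval_one` (Rolfsen §8.D; Crowell–Fox Ch. IX (1.1)) follows from
the named fact `Knot.fg_group` (hypothesis `hfg`) by the algebraic theorem
`Literature.Topology.FourManifolds.IsAlexanderPolynomial.isUnit_eval_one_of_fg` (Crowell–Fox Ch. IX (1.2), proved in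
`AlexanderModuleTrivializer`). Real proof. [cite: CrowellFox1963, Ch. IX (1.1)–(1.2)] -/
theorem IsAlexanderPolynomial.isUnit_eval_one_of_fg_group (hfg : fg_group) :
    IsAlexanderPolynomial.isUnit_eval_one := by
  intro K Δ h
  obtain ⟨x, hx⟩ := h
  haveI : Group.FG (K.group x) := hfg K x
  exact hx.isUnit_eval_one_of_fg

/-- Pointwise unconditional form: if the knot groups of `K` are finitely generated (e.g. once a
Wirtinger presentation of `K` is available), every Alexander polynomial `Δ` of `K` has
`Δ(1) = ±1`. Real proof. [cite: CrowellFox1963, Ch. IX (1.1)–(1.2)] -/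
theorem IsAlexanderPolynomial.isUnit_eval_one_of_groupFG {K : Knot}
    (hK : ∀ x : K.complement, Group.FG (K.group x)) {Δ : ℤ[T;T⁻¹]}
    (h : K.IsAlexanderPolynomial Δ) : IsUnit (LaurentPolynomial.eval₂ (RingHom.id ℤ) 1 Δ) := by
  obtain ⟨x, hx⟩ := h
  haveI : Group.FG (K.group x) := hK x
  exact hx.isUnit_eval_one_of_fg

end Knot

end Literature.Topology.FourManifolds
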